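import Mathlib
import Literature.Probability.RandomPlanarGeometry.CurveClassStopAtMeasurable
import HarnessLib

/-!
# Trace equality of `⨆ 𝔽_{σₙ}` and `σ(path stopped at τ_F)` on the announcing event (brick P1b)

Crux `AxiomsOfLimit` (stmt-CriticalPhenomena-1370), line `registered`, stub `stub_markovOfLimit`,
soft-Markov brick P1b "`⨆ₙ 𝔽_{σₙ}` and `σ(stopped path at τ_F)` have the same trace on the
announcing event" (lead c4). Theorems only.

Setting: the path space `Ω̃ = C([0,1], ℂ)` with its Borel σ-algebra, the stopping operators
`stop t ω = ω ∘ (id ⊓ const (projIcc t))`, the canonical filtration `𝔽 t = σ(stop t)`, a time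
`τ : Ω̃ → ℝ` (in the stub: the hitting parameter `τ_F` of a closed set `F`), the stopped path
`T ω = stop (τ ω) ω` and its σ-algebra `ℋ = σ(T)`, and rational-valued `𝔽`-stopping times `σₙ`
which ANNOUNCE `τ` on an event `B` (`σₙ < τ`, `σₙ → τ` on `B`) and are measurable functions of
the stopped path.  Then `𝒢 := ⨆ₙ 𝔽_{σₙ}` and `ℋ` have the same measurable subsets of `B`
(`stub_traceEqOnPathSpace`, via the abstract `traceEq_of_announcing`):

* `𝒢 → ℋ` (`trace_past_subset`): an `𝔽_{σₙ}`-set `A` splits along the countably many values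
  `q` of `σₙ`; `A ∩ {σₙ = q}` is `𝔽 q`-measurable, i.e. of the form `stop q ⁻¹' C_q`, and on
  `B ∩ {σₙ = q}` one has `q < τ`, so `stop q = stop q ∘ T` there, while
  `{σₙ = q} = T ⁻¹' (gₙ ⁻¹' {q})`;
* `ℋ → 𝒢` (`trace_stopped_closed` + induction over the Borel σ-algebra generated by closed sets):
  for closed `C`, on `B` the stopped paths `Vₙ ω = stop (σₙ ω) ω` (which are `𝒢`-measurable)
  converge to `T ω`, so `T ω ∈ C ↔ infDist (Vₙ ω) C → 0`.

This is the elementary form of `𝓕_{τ−} = ⋁ₙ 𝓕_{τₙ}` for announcing sequences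
(C. Dellacherie, P.-A. Meyer, *Probabilités et potentiel*, Chap. IV, no. 56) on the canonical
path space, where `𝓕_{τ−}` restricted to the announcing event is generated by the stopped path.
All `[folklore]`.
-/

noncomputable section

open MeasureTheory Set Filter Topology Metric

namespace Summit.CriticalPhenomena.SAWScalingLimit.Theorems.AxiomsOfLimitMarkov

open Literature.Probability.RandomPlanarGeometry

/-! ### Traces of σ-algebras on an event -/

/-- If every generator `A ∈ S` has an `m₀`-measurable trace on `B` (`A ∩ B = E ∩ B` with
`E ∈ m₀`), then so does every set of the σ-algebra generated by `S`. [folklore] -/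
theorem trace_of_generateFrom {α : Type*} {S : Set (Set α)} {m₀ : MeasurableSpace α} {B : Set α}
    (hS : ∀ A ∈ S, ∃ E, MeasurableSet[m₀] E ∧ A ∩ B = E ∩ B) {A : Set α}
    (hA : MeasurableSet[MeasurableSpace.generateFrom S] A) :
    ∃ E, MeasurableSet[m₀] E ∧ A ∩ B = E ∩ B := by
  induction hA with
  | basic u hu => exact hS u hu
  | empty => exact ⟨∅, @MeasurableSet.empty _ m₀, rfl⟩
  | compl u _ ih =>
    obtain ⟨E, hE, h⟩ := ih
    refine ⟨Eᶜ, hE.compl, Set.ext fun ω => ?_⟩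
    have := Set.ext_iff.1 h ω
    simp only [mem_inter_iff, mem_compl_iff] at this ⊢
    tauto
  | iUnion f _ ih =>
    choose E hE h using ih
    exact ⟨⋃ i, E i, MeasurableSet.iUnion hE, by
      rw [iUnion_inter, iUnion_inter]; exact iUnion_congr h⟩

/-- If every `m`-set has an `m'`-measurable trace on `B` and `B ∈ m'`, then every
`m`-measurable `B ∩ t` is `m'`-measurable. [folklore] -/
theorem measurableSet_inter_of_trace {α : Type*} {m m' : MeasurableSpace α} {B t : Set α}
    (hB : MeasurableSet[m'] B)
    (h : ∀ A, MeasurableSet[m] A → ∃ E, MeasurableSet[m'] E ∧ A ∩ B = E ∩ B)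
    (ht : MeasurableSet[m] (B ∩ t)) : MeasurableSet[m'] (B ∩ t) := by
  obtain ⟨E, hE, hEB⟩ := h _ ht
  rw [inter_right_comm, inter_self] at hEB
  rw [hEB]
  exact hE.inter hB

/-! ### The two generator computations -/

/-- **Past of a rational-valued announcer.** Let `S d` (`d : ℝ`) be stopping operators with
`S d ∘ S t = S d` for `d ≤ t`, `𝔽 d = σ(S d)`, `T = S τ` the path stopped at `τ`, and `ρ` a
rational-valued `𝔽`-stopping time with `ρ < τ` on `B` which is a measurable function of `T`.
Then every `𝔽_ρ`-set has a `σ(T)`-measurable trace on `B`. [folklore] -/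
theorem trace_past_subset {Ω : Type*} [MeasurableSpace Ω] {S : ℝ → Ω → Ω}
    (hSS : ∀ d t ω, d ≤ t → S d (S t ω) = S d ω) (hSm : ∀ t, Measurable (S t))
    {𝔽 : Filtration ℝ ‹MeasurableSpace Ω›}
    (h𝔽 : ∀ t, 𝔽 t = MeasurableSpace.comap (S t) inferInstance) {τ ρ : Ω → ℝ}
    (hρ : IsStoppingTime 𝔽 fun ω => ((ρ ω : ℝ) : WithTop ℝ))
    (hrange : ∀ ω, ρ ω ∈ range (fun q : ℚ => (q : ℝ))) {B : Set Ω}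
    (hlt : ∀ ω ∈ B, ρ ω < τ ω) {g : Ω → ℝ} (hg : Measurable g)
    (hρg : ∀ ω, ρ ω = g (S (τ ω) ω)) {A : Set Ω} (hA : MeasurableSet[hρ.measurableSpace] A) :
    ∃ E, MeasurableSet[MeasurableSpace.comap (fun ω => S (τ ω) ω) inferInstance] E ∧
      A ∩ B = E ∩ B := by
  have hq : ∀ q : ℚ, ∃ C : Set Ω, MeasurableSet C ∧
      S q ⁻¹' C = A ∩ {ω | ((ρ ω : ℝ) : WithTop ℝ) = ((q : ℝ) : WithTop ℝ)} := fun q => by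
    have h1 := (hρ.measurableSet_inter_eq_iff A (q : ℝ)).1
      (hA.inter (hρ.measurableSet_eq' (q : ℝ)))
    rw [h𝔽] at h1
    exact MeasurableSpace.measurableSet_comap.1 h1
  choose C hCm hC using hq
  refine ⟨⋃ q : ℚ, (fun ω => S (τ ω) ω) ⁻¹' (S q ⁻¹' C q ∩ g ⁻¹' {(q : ℝ)}),
    MeasurableSet.iUnion fun q => MeasurableSpace.measurableSet_comap.2
      ⟨_, ((hCm q).preimage (hSm q)).inter (hg (measurableSet_singleton _)), rfl⟩, ?_⟩
  ext ω
  simp only [mem_inter_iff, mem_iUnion, mem_preimage, mem_singleton_iff]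
  constructor
  · rintro ⟨hωA, hωB⟩
    obtain ⟨q, hq⟩ := hrange ω
    have hq : ((q : ℚ) : ℝ) = ρ ω := hq
    have hle : ((q : ℚ) : ℝ) ≤ τ ω := by rw [hq]; exact (hlt ω hωB).le
    refine ⟨⟨q, ?_, ?_⟩, hωB⟩
    · rw [hSS _ _ _ hle]
      have : ω ∈ S q ⁻¹' C q := by
        rw [hC q]
        exact ⟨hωA, by rw [mem_setOf_eq, ← hq]⟩
      exact this
    · rw [← hρg, ← hq]
  · rintro ⟨⟨q, hSq, hgq⟩, hωB⟩
    have hq : ρ ω = q := by rw [hρg]; exact hgq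
    have hle : ((q : ℚ) : ℝ) ≤ τ ω := by rw [← hq]; exact (hlt ω hωB).le
    refine ⟨?_, hωB⟩
    rw [hSS _ _ _ hle] at hSq
    have : ω ∈ S q ⁻¹' C q := hSq
    rw [hC q] at this
    exact this.1

/-- **Stopped path at an announced time, closed generators.** On the path space
`C([0,1], ℂ)`: if `t ↦ S t ω` is continuous, `𝔽 t = σ(S t)`, the `σₙ` are rational-valued
`𝔽`-stopping times with `σₙ → τ` on `B`, then for every closed `C` the set
`{ω | S (τ ω) ω ∈ C}` has a `⨆ₙ 𝔽_{σₙ}`-measurable trace on `B`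
(`S (σₙ ω) ω → S (τ ω) ω` on `B`, and `ω ↦ S (σₙ ω) ω` is `𝔽_{σₙ}`-measurable). [folklore] -/
theorem trace_stopped_closed [MeasurableSpace C(unitInterval, ℂ)] [BorelSpace C(unitInterval, ℂ)]
    {S : ℝ → C(unitInterval, ℂ) → C(unitInterval, ℂ)} (hSc : ∀ ω, Continuous fun t => S t ω)
    {𝔽 : Filtration ℝ ‹MeasurableSpace C(unitInterval, ℂ)›}
    (h𝔽 : ∀ t, 𝔽 t = MeasurableSpace.comap (S t) inferInstance)
    {τ : C(unitInterval, ℂ) → ℝ} {σ : ℕ → C(unitInterval, ℂ) → ℝ}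
    (hσ : ∀ n, IsStoppingTime 𝔽 fun ω => ((σ n ω : ℝ) : WithTop ℝ))
    (hrange : ∀ n ω, σ n ω ∈ range (fun q : ℚ => (q : ℝ))) {B : Set C(unitInterval, ℂ)}
    (htend : ∀ ω ∈ B, Tendsto (fun n => σ n ω) atTop (𝓝 (τ ω))) {C : Set C(unitInterval, ℂ)}
    (hC : IsClosed C) :
    ∃ E, MeasurableSet[⨆ n, (hσ n).measurableSpace] E ∧
      (fun ω => S (τ ω) ω) ⁻¹' C ∩ B = E ∩ B := by
  rcases C.eq_empty_or_nonempty with rfl | hCne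
  · exact ⟨∅, @MeasurableSet.empty _ (⨆ n, (hσ n).measurableSpace), by simp⟩
  -- the stopped paths `V n ω = S (σ n ω) ω` are `𝒢`-measurable
  have hV : ∀ n, Measurable[⨆ n, (hσ n).measurableSpace] fun ω => S (σ n ω) ω := by
    intro n D hD
    have hdec : (fun ω => S (σ n ω) ω) ⁻¹' D =
        ⋃ q : ℚ, (S q ⁻¹' D ∩ {ω | ((σ n ω : ℝ) : WithTop ℝ) = ((q : ℝ) : WithTop ℝ)}) := by
      ext ω
      simp only [mem_preimage, mem_iUnion, mem_inter_iff, mem_setOf_eq, WithTop.coe_eq_coe]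
      constructor
      · intro h
        obtain ⟨q, hq⟩ := hrange n ω
        have hq : ((q : ℚ) : ℝ) = σ n ω := hq
        exact ⟨q, by rwa [hq], hq.symm⟩
      · rintro ⟨q, h, hq⟩
        rwa [hq]
    rw [hdec]
    refine MeasurableSet.iUnion fun q => le_iSup (fun n => (hσ n).measurableSpace) n _ ?_
    rw [(hσ n).measurableSet_inter_eq_iff]
    refine MeasurableSet.inter ?_ ((hσ n).measurableSet_eq _)
    rw [h𝔽]
    exact comap_measurable _ hD
  have hf : ∀ n, Measurable[⨆ n, (hσ n).measurableSpace] fun ω => infDist (S (σ n ω) ω) C :=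
    fun n => (continuous_infDist_pt C).measurable.comp (hV n)
  refine ⟨⋂ j : ℕ, ⋃ N : ℕ, ⋂ n : ℕ, ⋂ (_ : N ≤ n),
      (fun ω => infDist (S (σ n ω) ω) C) ⁻¹' Iio (1 / ((j : ℝ) + 1)),
    MeasurableSet.iInter fun j => MeasurableSet.iUnion fun N => MeasurableSet.iInter fun n =>
      MeasurableSet.iInter fun _ => hf n measurableSet_Iio, ?_⟩
  ext ω
  simp only [mem_inter_iff, mem_iInter, mem_iUnion, mem_preimage, mem_Iio]
  have key : ω ∈ B → Tendsto (fun n => infDist (S (σ n ω) ω) C) atTop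
      (𝓝 (infDist (S (τ ω) ω) C)) := fun hB =>
    ((continuous_infDist_pt C).tendsto _).comp (((hSc ω).tendsto _).comp (htend ω hB))
  constructor
  · rintro ⟨hωC, hB⟩
    refine ⟨fun j => eventually_atTop.1 ?_, hB⟩
    have h := key hB
    rw [infDist_zero_of_mem hωC] at h
    exact h.eventually (gt_mem_nhds Nat.one_div_pos_of_nat)
  · rintro ⟨h, hB⟩
    refine ⟨(hC.mem_iff_infDist_zero hCne).2
      (le_antisymm (not_lt.1 fun hpos => ?_) infDist_nonneg), hB⟩
    obtain ⟨j, hj⟩ := exists_nat_one_div_lt hpos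
    obtain ⟨N, hN⟩ := h j
    exact not_le.2 hj (le_of_tendsto (key hB) (eventually_atTop.2 ⟨N, fun n hn => (hN n hn).le⟩))

/-! ### The abstract trace equality and the stopping operators of the path space -/

/-- **Trace equality on an announcing event (abstract stopping operators).** On `C([0,1], ℂ)`
with stopping operators `S` (`S d ∘ S t = S d` for `d ≤ t`, continuous in `t`, Borel in `ω`),
the canonical filtration `𝔽 t = σ(S t)`, a time `τ`, and rational-valued `𝔽`-stopping times
`σₙ` announcing `τ` on `B` (`σₙ < τ`, `σₙ → τ` on `B`), measurable in the stopped path `S τ`,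
with `B ∈ σ(S τ) ∩ ⨆ₙ 𝔽_{σₙ}`: the σ-algebras `⨆ₙ 𝔽_{σₙ}` and `σ(S τ)` have the same measurable
subsets of `B`. [folklore] -/
theorem traceEq_of_announcing [MeasurableSpace C(unitInterval, ℂ)] [BorelSpace C(unitInterval, ℂ)]
    {S : ℝ → C(unitInterval, ℂ) → C(unitInterval, ℂ)}
    (hSS : ∀ d t ω, d ≤ t → S d (S t ω) = S d ω) (hSc : ∀ ω, Continuous fun t => S t ω)
    (hSm : ∀ t, Measurable (S t)) (𝔽 : Filtration ℝ ‹MeasurableSpace C(unitInterval, ℂ)›)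
    (h𝔽 : ∀ t, 𝔽 t = MeasurableSpace.comap (S t) inferInstance) (τ : C(unitInterval, ℂ) → ℝ)
    {σ : ℕ → C(unitInterval, ℂ) → ℝ}
    (hσ : ∀ n, IsStoppingTime 𝔽 fun ω => ((σ n ω : ℝ) : WithTop ℝ))
    (hrange : ∀ n ω, σ n ω ∈ range (fun q : ℚ => (q : ℝ))) {B : Set C(unitInterval, ℂ)}
    (hlt : ∀ ω ∈ B, ∀ n, σ n ω < τ ω)
    (htend : ∀ ω ∈ B, Tendsto (fun n => σ n ω) atTop (𝓝 (τ ω)))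
    (hBH : MeasurableSet[MeasurableSpace.comap (fun ω => S (τ ω) ω) inferInstance] B)
    (hBG : MeasurableSet[⨆ n, (hσ n).measurableSpace] B)
    (hfac : ∀ n, ∃ g : C(unitInterval, ℂ) → ℝ, Measurable g ∧ ∀ ω, σ n ω = g (S (τ ω) ω))
    (t : Set C(unitInterval, ℂ)) :
    MeasurableSet[⨆ n, (hσ n).measurableSpace] (B ∩ t) ↔
      MeasurableSet[MeasurableSpace.comap (fun ω => S (τ ω) ω) inferInstance] (B ∩ t) := by
  have P : ∀ A, MeasurableSet[⨆ n, (hσ n).measurableSpace] A → ∃ E,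
      MeasurableSet[MeasurableSpace.comap (fun ω => S (τ ω) ω) inferInstance] E ∧
        A ∩ B = E ∩ B := by
    intro A hA
    rw [MeasurableSpace.measurableSpace_iSup_eq] at hA
    refine trace_of_generateFrom (fun A' hA' => ?_) hA
    obtain ⟨n, hn⟩ := hA'
    obtain ⟨g, hg, hσg⟩ := hfac n
    exact trace_past_subset hSS hSm h𝔽 (hσ n) (hrange n) (fun ω hω => hlt ω hω n) hg hσg hn
  have Q : ∀ A, MeasurableSet[MeasurableSpace.comap (fun ω => S (τ ω) ω) inferInstance] A →
      ∃ E, MeasurableSet[⨆ n, (hσ n).measurableSpace] E ∧ A ∩ B = E ∩ B := by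
    intro A hA
    have hgen : MeasurableSpace.comap (fun ω => S (τ ω) ω)
        (inferInstance : MeasurableSpace C(unitInterval, ℂ)) = MeasurableSpace.generateFrom
          (Set.preimage (fun ω => S (τ ω) ω) '' {C : Set C(unitInterval, ℂ) | IsClosed C}) := by
      rw [← MeasurableSpace.comap_generateFrom, ← borel_eq_generateFrom_isClosed,
        ← BorelSpace.measurable_eq]
    rw [hgen] at hA
    refine trace_of_generateFrom (fun A' hA' => ?_) hA
    obtain ⟨C, hC, rfl⟩ := hA'
    exact trace_stopped_closed hSc h𝔽 hσ hrange htend hC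
  exact ⟨measurableSet_inter_of_trace hBH P, measurableSet_inter_of_trace hBG Q⟩

/-- The clock `t ↦ id ⊓ const (projIcc t) : ℝ → C([0,1], [0,1])` of the stopping operators is
continuous. [folklore] -/
theorem continuous_stopClock : Continuous fun t : ℝ => ContinuousMap.id unitInterval ⊓
    ContinuousMap.const unitInterval (Set.projIcc (0:ℝ) 1 zero_le_one t) :=
  (ContinuousMap.continuous_of_continuous_uncurry
    (fun c : unitInterval => ContinuousMap.id unitInterval ⊓ ContinuousMap.const unitInterval c)
    (continuous_snd.inf continuous_fst)).comp continuous_projIcc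

/-- `t ↦ stop t ω = ω ∘ (id ⊓ const (projIcc t))` is continuous (uniform continuity of `ω`).
[folklore] -/
theorem continuous_stop (ω : C(unitInterval, ℂ)) : Continuous fun t : ℝ => ω.comp
    (ContinuousMap.id unitInterval ⊓
      ContinuousMap.const unitInterval (Set.projIcc (0:ℝ) 1 zero_le_one t)) :=
  (ContinuousMap.continuous_postcomp ω).comp continuous_stopClock

/-- The stopping operator `ω ↦ ω ∘ (id ⊓ const c)` is Borel on `C([0,1], ℂ)` (it is continuous).
[folklore] -/
theorem measurable_stop [MeasurableSpace C(unitInterval, ℂ)] [BorelSpace C(unitInterval, ℂ)]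
    (c : unitInterval) : Measurable fun ω : C(unitInterval, ℂ) =>
      ω.comp (ContinuousMap.id unitInterval ⊓ ContinuousMap.const unitInterval c) :=
  (ContinuousMap.continuous_precomp _).measurable

/-- Stopping is transitive: stopping at `c'` and then at `c ≤ c'` is stopping at `c`. [folklore] -/
theorem comp_stop_of_le {c c' : unitInterval} (h : c ≤ c') (ω : C(unitInterval, ℂ)) :
    (ω.comp (ContinuousMap.id unitInterval ⊓ ContinuousMap.const unitInterval c')).comp
        (ContinuousMap.id unitInterval ⊓ ContinuousMap.const unitInterval c) =
      ω.comp (ContinuousMap.id unitInterval ⊓ ContinuousMap.const unitInterval c) := by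
  refine ContinuousMap.ext fun u => ?_
  simp only [ContinuousMap.comp_apply, ContinuousMap.inf_apply, ContinuousMap.id_apply,
    ContinuousMap.const_apply]
  rw [inf_eq_left.2 (inf_le_right.trans h)]

/-- **Soft-Markov brick P1b (registered stub `stub_traceEqOnPathSpace`).** On the path space
`C([0,1], ℂ)` with the canonical filtration `𝔽 t = σ(path stopped at t)`: if rational-valued
increasing stopping times `σₙ` announce the hitting time `τ_F` of a closed set `F` on an event
`B` (`σₙ < τ_F`, `σₙ → τ_F` on `B`), `B` lies in both `𝒢 = ⨆ₙ 𝔽_{σₙ}` and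
`ℋ = σ(path stopped at τ_F)`, and each `σₙ` is a measurable function of the path stopped at
`τ_F`, then `𝒢` and `ℋ` have the same measurable subsets of `B`
(Dellacherie–Meyer IV.56: `𝓕_{τ−} = ⋁ₙ 𝓕_{σₙ}`). [folklore] -/
theorem stub_traceEqOnPathSpace : ∀ [MeasurableSpace C(unitInterval, ℂ)] [BorelSpace C(unitInterval, ℂ)] (𝔽 : MeasureTheory.Filtration ℝ (inferInstance : MeasurableSpace C(unitInterval, ℂ))), (∀ t : ℝ, 𝔽 t = MeasurableSpace.comap (fun ω : C(unitInterval, ℂ) => ((ω).comp (ContinuousMap.id unitInterval ⊓ ContinuousMap.const unitInterval (Set.projIcc (0:ℝ) 1 zero_le_one (t))))) inferInstance) → ∀ (F : Set ℂ), IsClosed F → ∀ (σ : ℕ → C(unitInterval, ℂ) → ℝ) (hσ : ∀ n, MeasureTheory.IsStoppingTime 𝔽 (fun ω => ((σ n ω : ℝ) : WithTop ℝ))), (∀ n ω, σ n ω ∈ Set.range (fun q : ℚ => (q : ℝ))) → (∀ n ω, σ n ω ≤ σ (n + 1) ω) → (∀ n ω, σ n ω ≤ 1) → ∀ (B : Set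 C(unitInterval, ℂ)), (∀ ω ∈ B, ∀ n, σ n ω < ((Literature.Probability.RandomPlanarGeometry.Curve.mk (ω)).hitParam F)) → (∀ ω ∈ B, Filter.Tendsto (fun n => σ n ω) Filter.atTop (nhds ((Literature.Probability.RandomPlanarGeometry.Curve.mk (ω)).hitParam F))) → @MeasurableSet C(unitInterval, ℂ) (MeasurableSpace.comap (fun ω : C(unitInterval, ℂ) => ((ω).comp (ContinuousMap.id unitInterval ⊓ ContinuousMap.const unitInterval (Set.projIcc (0:ℝ) 1 zero_le_one (((Literature.Probability.RandomPlanarGeometry.Curve.mk (ω)).hitParam F)))))) inferInstance) B → @MeasurableSet C(unitInterval, ℂ) (⨆ n, (hσ n).measurableSpace) B → (∀ n, ∃ g : C(unitInterval, ℂ) → ℝ, Measurable g ∧ ∀ ω, σ n ω = g ((ω).comp (ContinuousMap.id unitInterval ⊓ ContinuousMap.const unitInterval (Set.projIcc (0:ℝ) 1 zero_le_one (((Literature.Probability.RandomPlanarGeometry.Curve.mk (ω)).hitParam F)))))) → ∀ t : Set C(unitInterval, ℂ), @MeasurableSet C(unitInterval, ℂ) (⨆ n, (hσ n).measurableSpace)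 (B ∩ t) ↔ @MeasurableSet C(unitInterval, ℂ) (MeasurableSpace.comap (fun ω : C(unitInterval, ℂ) => ((ω).comp (ContinuousMap.id unitInterval ⊓ ContinuousMap.const unitInterval (Set.projIcc (0:ℝ) 1 zero_le_one (((Literature.Probability.RandomPlanarGeometry.Curve.mk (ω)).hitParam F)))))) inferInstance) (B ∩ t) := by
  intro _ _ 𝔽 h𝔽 F _ σ hσ hrange _ _ B hlt htend hBH hBG hfac t
  exact traceEq_of_announcing
    (S := fun (t : ℝ) (ω : C(unitInterval, ℂ)) => ω.comp (ContinuousMap.id unitInterval ⊓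
      ContinuousMap.const unitInterval (Set.projIcc (0:ℝ) 1 zero_le_one t)))
    (fun d t ω h => comp_stop_of_le (Set.monotone_projIcc zero_le_one h) ω)
    continuous_stop (fun t => measurable_stop _) 𝔽 h𝔽 (fun ω => (Curve.mk ω).hitParam F)
    hσ hrange hlt htend hBH hBG hfac t

end Summit.CriticalPhenomena.SAWScalingLimit.Theorems.AxiomsOfLimitMarkov

end
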